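import Summits.CriticalPhenomena.PercolationContinuityZ3.Theorems.PercNearOneGluingNoHeavyLowerTailKNGoodHairTools
import HarnessLib

/-!
# Kozma–Nitzan GOODNESS is monotone under raising relay hairs AT THE OBSERVER
# (`NoHeavyLowerTail` cell, stmt-CriticalPhenomena-4575; prover `prim-hp-2`, deletion–contraction line, gen 3)

Support file (`--supports stmt-CriticalPhenomena-4575`).  No definitions, no named facts, no sorries.
Kozma–Nitzan (arXiv:2401.12397, §3.2 p. 12) call `(G, A, 0, b)` GOOD if
`P(0 ↔ b) ≥ min_a P(a ↔ b) − Σ_{W ∩ A = ∅} P(C(0) = W) · min_a P_{G∖W}(a ↔ b)` (tree: `KNGood`, with Thm 4 / Thm 5 proved as printed);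
goodness implies their inequality (2) and Conjecture 1 at `0` (`KNGood.preFKG2`).  Theorem 5 allows relay pairs ("hairs") at `0`
next to ONE Steiner neighbour.  This file proves that hairs at the observer are free in general:

* `KNGoodHair.knGood_mono_pair` — **one pair at the observer**: for `v ∉ A`, any vertex `y ≠ v` and `t ≤ w s(v,y)`: if
  `(G[s(v,y) ↦ t], A, v, b)` is good and, in `G[s(v,y) ↦ t]`, `y` is no lonelier than the loneliest relay
  (`min_a P(a ↔ b) ≤ P(y ↔ b)`), then `(G, A, v, b)` is good.  Deletion–contraction in the pair `e = s(v,y)`: with `a` the minimiser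
  of `P_{G[e↦t]}(· ↔ b)` over `A`, `F(u) := P_{G[e↦u]}(v ↔ b) − P_{G[e↦u]}(a ↔ b) + Σ_W P_{G[e↦u]}(C(v) = W) min P_{G∖W}(· ↔ b)` is AFFINE
  in `u` (the minima do not feel `e`: `v ∈ W`), `F(t) ≥ 0` is the hypothesis, and `F(1) ≥ 0` is the in-graph gluing transfer
  `KNGoodHair.glueTransfer_openConn` (`a` is no better connected than `y`, hence no better than `v` once `v` is glued to `y`);
  so `F(w e) ≥ 0`, which is goodness with the witness `a`.
* `KNGoodHair.knGood_mono_hair` — **a relay hair** (`y = p ∈ A`, the loneliness condition is automatic);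
  `KNGoodHair.knGood_of_le_on_hairs` — all relay hairs at once (`w' ≤ w`, `w' = w` except on relay pairs at `v`);
  `KNGoodHair.knGood_of_deleteHairs` — the case `w'` = `w` with every relay pair at `v` closed.
* `KNGoodHair.knGood_oneNeighbour_of_notLonely` — **Theorem 5 with "`(G∖0, A, x, b)` good" replaced by "`x` is no lonelier than
  the loneliest relay in `G[s(0,x) ↦ 0]`"**, for an ARBITRARY graph beyond `x`.

So KN-goodness of an observer never deteriorates when relay hairs are attached to it, nor when it is joined to a vertex at
least as connected as the loneliest relay — the proved part of the witness-monotonicity principle behind the branching step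
of this line (seat notes, Conjecture M: the same for pairs towards LONELY Steiner vertices would make goodness propagate
through every branching Steiner vertex, hence hold for every observer).
-/

noncomputable section

namespace Summit.CriticalPhenomena.PercolationContinuityZ3.Theorems

open MeasureTheory Set Literature.Probability.LatticeModels Literature.Probability.Percolation
open scoped Classical BigOperators

variable {n : ℕ}

namespace KNGoodHair

open ChampionStability KNGoodAux

/-- Paths avoiding `W ∋ v` do not use the pair `s(v,p)`. [folklore] -/
theorem preimage_insert_openConnIn_eq (W : Finset (Fin n)) (v p a b : Fin n) (hvW : v ∈ W) :
    (fun ω : BondConfig (Fin n) => insert s(v, p) ω) ⁻¹' (openConnIn ((↑W : Set (Fin n))ᶜ) a b) =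
      openConnIn ((↑W : Set (Fin n))ᶜ) a b := by
  have hind : ∀ ω : BondConfig (Fin n),
      (openGraph (insert s(v, p) ω)).induce ((↑W : Set (Fin n))ᶜ) = (openGraph ω).induce ((↑W : Set (Fin n))ᶜ) := by
    intro ω
    ext x y
    simp only [SimpleGraph.induce_adj, openGraph_adj, Set.mem_insert_iff]
    constructor
    · rintro ⟨h | h, hne⟩
      · exfalso
        have hvx : v ∈ s((x : Fin n), (y : Fin n)) := by rw [h]; exact Sym2.mem_mk_left v p
        rcases Sym2.mem_iff.1 hvx with hv | hv
        · exact x.2 (by rw [← hv]; exact Finset.mem_coe.2 hvW)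
        · exact y.2 (by rw [← hv]; exact Finset.mem_coe.2 hvW)
      · exact ⟨h, hne⟩
    · rintro ⟨h, hne⟩
      exact ⟨Or.inr h, hne⟩
  ext ω
  simp only [mem_preimage, openConnIn, mem_setOf_eq, hind ω]

/-- **Goodness is monotone under raising a pair at the observer towards a vertex that is no lonelier than the loneliest
relay.**  `y ≠ v` any vertex, `t ≤ w s(v,y)`; if `(G[s(v,y) ↦ t], A, v, b)` is good and, in `G[s(v,y) ↦ t]`,
`min_{a ∈ A} P(a ↔ b) ≤ P(y ↔ b)`, then `(G, A, v, b)` is good.  Deletion–contraction in `e = s(v,y)`: with `a` the minimiser,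
`F(u) = P_{G[e↦u]}(v ↔ b) − P_{G[e↦u]}(a ↔ b) + Σ_W P_{G[e↦u]}(C(v) = W)·min P_{G∖W}(· ↔ b)` is affine in `u` (the minima do not
feel `e` since `v ∈ W`), `F(t) ≥ 0` by hypothesis, `F(1) ≥ 0` by the in-graph gluing transfer. [cite: KozmaNitzan2024, §3.2 Definition (p. 12), Thm. 5 (p. 13) — extension; VandenbergHaggstromKahn2005, Thm. 1.5 (p. 7)] -/
theorem knGood_mono_pair (w : Sym2 (Fin n) → unitInterval) (A : Finset (Fin n)) (hA : A.Nonempty)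
    (v b y : Fin n) (hyv : y ≠ v) (t : unitInterval) (ht : t ≤ w s(v, y))
    (hgood : KNGood (Function.update w s(v, y) t) A hA v b)
    (hy : A.inf' hA (fun a => (prodBernoulli (Function.update w s(v, y) t)).real (openConn a b)) ≤
      (prodBernoulli (Function.update w s(v, y) t)).real (openConn y b)) : KNGood w A hA v b := by
  have hvy : v ≠ y := fun h => hyv h.symm
  set μ0 := prodBernoulli (Function.update w s(v, y) 0) with hμ0
  set μ1 := prodBernoulli (Function.update w s(v, y) 1) with hμ1
  -- one-bond decomposition at `e = s(v,y)` for the weights `w[e ↦ u]`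
  have hdec : ∀ (u : unitInterval) (S : Set (BondConfig (Fin n))),
      (prodBernoulli (Function.update w s(v, y) u)).real S = (1 - (u : ℝ)) * μ0.real S + (u : ℝ) * μ1.real S := by
    intro u S
    have h := stub_oneBondDecomp_k15 n (Function.update w s(v, y) u) s(v, y) S
    rwa [Function.update_idem, Function.update_idem, Function.update_self] at h
  -- the pocket correction is affine in `u`: the minima do not feel `e`
  set D0 : ℝ := ∑ W ∈ nullSets A, μ0.real (clusterIs v W) *
      A.inf' hA (fun a => μ0.real (openConnIn ((↑W : Set (Fin n))ᶜ) a b)) with hD0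
  set D1 : ℝ := ∑ W ∈ nullSets A, μ1.real (clusterIs v W) *
      A.inf' hA (fun a => μ0.real (openConnIn ((↑W : Set (Fin n))ᶜ) a b)) with hD1
  have hD1nn : 0 ≤ D1 := by
    rw [hD1]
    refine Finset.sum_nonneg fun W _ => mul_nonneg measureReal_nonneg ?_
    exact (Finset.le_inf'_iff hA _).2 fun a _ => measureReal_nonneg
  have hD : ∀ u : unitInterval,
      ∑ W ∈ nullSets A, (prodBernoulli (Function.update w s(v, y) u)).real (clusterIs v W) *
          A.inf' hA (fun a => (prodBernoulli (Function.update w s(v, y) u)).real (openConnIn ((↑W : Set (Fin n))ᶜ) a b)) =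
        (1 - (u : ℝ)) * D0 + (u : ℝ) * D1 := by
    intro u
    rw [hD0, hD1, Finset.mul_sum, Finset.mul_sum, ← Finset.sum_add_distrib]
    refine Finset.sum_congr rfl fun W _ => ?_
    by_cases hvW : v ∈ W
    · have hinf : A.inf' hA (fun a => (prodBernoulli (Function.update w s(v, y) u)).real
            (openConnIn ((↑W : Set (Fin n))ᶜ) a b)) =
          A.inf' hA (fun a => μ0.real (openConnIn ((↑W : Set (Fin n))ᶜ) a b)) := by
        refine Finset.inf'_congr hA rfl fun a _ => ?_
        rw [hμ0]
        exact real_update_eq_of_preimage_insert_eq w s(v, y) _ (preimage_insert_openConnIn_eq W v y a b hvW) u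
      rw [hdec u, hinf]
      ring
    · have hempty : (clusterIs v W : Set (BondConfig (Fin n))) = ∅ := by
        ext ω
        simp only [mem_empty_iff_false, iff_false]
        intro hω
        rw [mem_clusterIs] at hω
        have : v ∈ openCluster ω v := mem_openCluster_self ω v
        rw [hω, Finset.mem_coe] at this
        exact hvW this
      rw [hempty, measureReal_empty, measureReal_empty, measureReal_empty]
      ring
  -- the witness: `a` minimises `P_{w[e↦t]}(· ↔ b)` over `A`
  obtain ⟨a, ha, hmin⟩ :=
    A.exists_min_image (fun a => (prodBernoulli (Function.update w s(v, y) t)).real (openConn a b)) hA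
  have hinf_t : A.inf' hA (fun a' => (prodBernoulli (Function.update w s(v, y) t)).real (openConn a' b)) =
      (prodBernoulli (Function.update w s(v, y) t)).real (openConn a b) :=
    le_antisymm (Finset.inf'_le _ ha) ((Finset.le_inf'_iff hA _).2 hmin)
  -- `F(1) ≥ 0`: the in-graph gluing transfer
  have hF1 : μ1.real (openConn a b) ≤ μ1.real (openConn v b) := by
    have h := glueTransfer_openConn (Function.update w s(v, y) t) v y a b hvy (by rw [← hinf_t]; exact hy)
    rwa [Function.update_idem] at h
  -- `F(t) ≥ 0`: the hypothesis
  have hgood' := hgood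
  rw [KNGood, hinf_t, hD t] at hgood'
  -- the decompositions at `t` and at `s = w e`
  have hvt := hdec t (openConn v b)
  have hat := hdec t (openConn a b)
  have key : KNGood (Function.update w s(v, y) (w s(v, y))) A hA v b := by
    rw [KNGood, hD (w s(v, y))]
    have hvs := hdec (w s(v, y)) (openConn v b)
    have has := hdec (w s(v, y)) (openConn a b)
    have hinf_s : A.inf' hA (fun a' => (prodBernoulli (Function.update w s(v, y) (w s(v, y)))).real (openConn a' b)) ≤
        (prodBernoulli (Function.update w s(v, y) (w s(v, y)))).real (openConn a b) := Finset.inf'_le _ ha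
    have hts : (t : ℝ) ≤ (w s(v, y) : ℝ) := ht
    have ht0 : 0 ≤ (t : ℝ) := t.2.1
    have hs1 : (w s(v, y) : ℝ) ≤ 1 := (w s(v, y)).2.2
    -- F(u) = (1-u) F0 + u F1 with F1 ≥ 0, F(t) ≥ 0, s ≥ t ⇒ F(s) ≥ 0
    set F0 : ℝ := μ0.real (openConn v b) - μ0.real (openConn a b) + D0 with hF0
    set F1 : ℝ := μ1.real (openConn v b) - μ1.real (openConn a b) + D1 with hF1'
    have hF1nn : 0 ≤ F1 := by rw [hF1']; linarith
    have hFt : 0 ≤ (1 - (t : ℝ)) * F0 + (t : ℝ) * F1 := by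
      rw [hF0, hF1']; nlinarith [hgood', hvt, hat]
    have hFs : 0 ≤ (1 - (w s(v, y) : ℝ)) * F0 + (w s(v, y) : ℝ) * F1 := by
      by_cases h0 : 0 ≤ F0
      · nlinarith
      · push Not at h0
        nlinarith
    rw [hF0, hF1'] at hFs
    nlinarith [hFs, hvs, has, hinf_s]
  rwa [Function.update_eq_self] at key

/-- **Goodness is monotone under raising one relay hair at the observer.**  `v ∉ A`, `p ∈ A`, `t ≤ w s(v,p)`:
`KNGood (w[s(v,p) ↦ t]) A v b → KNGood w A v b` (`knGood_mono_pair` with `y = p`: a relay is never lonelier than the loneliest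
relay). [cite: KozmaNitzan2024, §3.2 Definition (p. 12), Thm. 5 (p. 13) — extension; VandenbergHaggstromKahn2005, Thm. 1.5 (p. 7)] -/
theorem knGood_mono_hair (w : Sym2 (Fin n) → unitInterval) (A : Finset (Fin n)) (hA : A.Nonempty)
    (v b p : Fin n) (hv : v ∉ A) (hp : p ∈ A) (t : unitInterval) (ht : t ≤ w s(v, p))
    (hgood : KNGood (Function.update w s(v, p) t) A hA v b) : KNGood w A hA v b :=
  knGood_mono_pair w A hA v b p (fun h => hv (h ▸ hp)) t ht hgood (Finset.inf'_le _ hp)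

/-- **Goodness is monotone under raising any set of relay hairs at the observer.**  If `w' ≤ w` pointwise, `w'` agrees
with `w` except on pairs `s(v,p)` with `p ∈ A`, and `(G_{w'}, A, v, b)` is good, then `(G_w, A, v, b)` is good.
[cite: KozmaNitzan2024, §3.2 (p. 12), Thm. 5 (p. 13) — extension] -/
theorem knGood_of_le_on_hairs (A : Finset (Fin n)) (hA : A.Nonempty) (v b : Fin n) (hv : v ∉ A) :
    ∀ (m : ℕ) (w w' : Sym2 (Fin n) → unitInterval),
      (Finset.univ.filter fun e : Sym2 (Fin n) => w' e ≠ w e).card = m →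
      (∀ e : Sym2 (Fin n), w' e ≠ w e → ∃ p ∈ A, e = s(v, p)) →
      (∀ e : Sym2 (Fin n), w' e ≤ w e) →
      KNGood w' A hA v b → KNGood w A hA v b := by
  intro m
  induction m with
  | zero =>
    intro w w' hm _ _ hgood
    have hww : w' = w := by
      funext e
      by_contra hne
      have : e ∈ (Finset.univ.filter fun e : Sym2 (Fin n) => w' e ≠ w e) := Finset.mem_filter.2 ⟨Finset.mem_univ _, hne⟩
      rw [Finset.card_eq_zero] at hm
      rw [hm] at this
      exact Finset.notMem_empty e this
    rwa [hww] at hgood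
  | succ m ih =>
    intro w w' hm hdiff hle hgood
    obtain ⟨e, he⟩ := Finset.card_pos.1 (by omega : 0 < (Finset.univ.filter fun e : Sym2 (Fin n) => w' e ≠ w e).card)
    have hne : w' e ≠ w e := (Finset.mem_filter.1 he).2
    obtain ⟨p, hp, rfl⟩ := hdiff e hne
    -- raise the hair `s(v,p)` of `w'` to its value in `w`
    set w'' : Sym2 (Fin n) → unitInterval := Function.update w' s(v, p) (w s(v, p)) with hw''
    have hgood'' : KNGood w'' A hA v b := by
      have h1 : Function.update w'' s(v, p) (w' s(v, p)) = w' := by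
        rw [hw'', Function.update_idem, Function.update_eq_self]
      refine knGood_mono_hair w'' A hA v b p hv hp (w' s(v, p)) ?_ (by rw [h1]; exact hgood)
      rw [hw'', Function.update_self]
      exact hle _
    have hcount : (Finset.univ.filter fun e : Sym2 (Fin n) => w'' e ≠ w e).card = m := by
      have hset : (Finset.univ.filter fun e : Sym2 (Fin n) => w'' e ≠ w e) =
          (Finset.univ.filter fun e : Sym2 (Fin n) => w' e ≠ w e).erase s(v, p) := by
        ext e'
        simp only [Finset.mem_filter, Finset.mem_univ, true_and, Finset.mem_erase]
        by_cases h : e' = s(v, p)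
        · subst h; simp [hw'']
        · simp [hw'', h]
      rw [hset, Finset.card_erase_of_mem he, hm]
      rfl
    refine ih w w'' hcount ?_ ?_ hgood''
    · intro e' hne'
      by_cases h : e' = s(v, p)
      · exact ⟨p, hp, h⟩
      · have : w' e' ≠ w e' := by rwa [hw'', Function.update_of_ne h] at hne'
        exact hdiff e' this
    · intro e'
      by_cases h : e' = s(v, p)
      · subst h; rw [hw'', Function.update_self]
      · rw [hw'', Function.update_of_ne h]; exact hle e'

/-- **Relay hairs at the observer are free**: if `(G − {relay pairs at v}, A, v, b)` is good then `(G, A, v, b)` is good.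
Here `G − {relay pairs at v}` is `w` with every pair `s(v,p)`, `p ∈ A`, set to `0`.  (Kozma–Nitzan's Theorem 5 is the case in
which `v` has one further neighbour `x` with `(G∖v, A, x, b)` good; Theorem 4 the case with none.)
[cite: KozmaNitzan2024, Thm. 4 (p. 12), Thm. 5 (p. 13) — extension] -/
theorem knGood_of_deleteHairs (w : Sym2 (Fin n) → unitInterval) (A : Finset (Fin n)) (hA : A.Nonempty) (v b : Fin n)
    (hv : v ∉ A)
    (hgood : KNGood (fun e => if ∃ p ∈ A, e = s(v, p) then 0 else w e) A hA v b) : KNGood w A hA v b := by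
  set w' : Sym2 (Fin n) → unitInterval := fun e => if ∃ p ∈ A, e = s(v, p) then 0 else w e with hw'
  refine knGood_of_le_on_hairs A hA v b hv _ w w' rfl ?_ ?_ hgood
  · intro e hne
    by_contra h
    apply hne
    rw [hw']
    simp only [h, if_false]
  · intro e
    rw [hw']
    by_cases h : ∃ p ∈ A, e = s(v, p)
    · simp only [h, if_true]; exact unitInterval.nonneg _
    · simp only [h, if_false]; exact le_rfl

/-- **Kozma–Nitzan's Theorem 5 with the goodness of `x` replaced by "`x` is no lonelier than the loneliest relay".**
Let `v ∉ A` have positive-weight pairs only to relays and to one further vertex `x ≠ v`, and let `G₀ = G[s(v,x) ↦ 0]`.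
If `min_{a ∈ A} P_{G₀}(a ↔ b) ≤ P_{G₀}(x ↔ b)` then `(G, A, v, b)` is good — whatever lies beyond `x`.  (Theorem 4 makes
`(G₀, A, v, b)` good; then `knGood_mono_pair`.) [cite: KozmaNitzan2024, Thm. 4 (p. 12), Thm. 5 (p. 13) — variant] -/
theorem knGood_oneNeighbour_of_notLonely (w : Sym2 (Fin n) → unitInterval) (A : Finset (Fin n)) (hA : A.Nonempty)
    (v b x : Fin n) (hv : v ∉ A) (hxv : x ≠ v)
    (hiso : ∀ u : Fin n, u ≠ v → u ∉ A → u ≠ x → w s(v, u) = 0)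
    (hx : A.inf' hA (fun a => (prodBernoulli (Function.update w s(v, x) 0)).real (openConn a b)) ≤
      (prodBernoulli (Function.update w s(v, x) 0)).real (openConn x b)) : KNGood w A hA v b := by
  refine knGood_mono_pair w A hA v b x hxv 0 (unitInterval.nonneg _) ?_ hx
  refine KozmaNitzan2024_thm4_good _ A hA v b hv fun u huv huA => ?_
  by_cases hux : u = x
  · subst hux; exact Function.update_self ..
  · rw [Function.update_of_ne (fun h => hux ((Sym2.congr_right).1 h))]
    exact hiso u huv huA hux

end KNGoodHair

end Summit.CriticalPhenomena.PercolationContinuityZ3.Theorems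

end
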